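import Summits.AtomisticToContinuum.Crystallization.Theorems.ChartedZeroExcessLayeredLatticeLiouvilleYL
import Summits.AtomisticToContinuum.Crystallization.Theorems.ChartedZeroExcessLayeredLatticeLiouvilleYI

/-!
# Charted zero-excess layered-lattice Liouville — YM «TubeCut»: the output-tameness dial and the NEAR / FAR cut of the twin pair (lens-2 g67)

Node g67 of lens «structural dichotomy (special vs generic)» on docket `stmt-AtomisticToContinuum-26636`, beneath the record of CRITIC-LEDGER row 1217:
[MCMCᶜ] `MildCoolMoatClampedCoreP` ⟸ (QE) ∧ (QC) (part YI, glue PROVED) and (QC)(κ) ⟸ (QS)(κ) ⟸ (QU) `TubeCriticalUniquenessP` ⟸ (QH)(cN > 3/500) (parts YJ/YK/YL,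
PROVED), the open leaf of record being (QU) — local uniqueness of clamped equilibria in the sup-norm tube `dm = 1/2` around a `tameRadius`-tame critical filling —
with the critic's sizing verdict «(QH) at the record is a NON-perturbative Born comparison (mild amplitude 1/10 vs crude budget ϑp + ϑ_f ≲ 1/36); a theorem-grade
sibling requires the D_tame dial».  Row 1217 assigned g67: TYPE THE DIAL.  Imports part YL (pending, after YK) and the tree part YI; lands after YL.

* **YM-1 THE DIAL `ϑ` (11 lemmas, PROVED) AND THE WINDOW LEMMA.**  The filling tameness is ALREADY the second argument of (QE) `CoolMoatSlavedFillingP ϑc ϑ ϑp …`, so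
  «(QE_f)» := (QE)(ϑm, ϑf, ϑp, …) needs no new definition — what was missing is its USE BELOW THE HOT LEVEL: the doors [MCMC]/[MCMCᶜ] weaken as `ϑ ↑`
  (`MildCoolMoatCorePG.of_tame_le`, `MildCoolMoatClampedCoreP.of_tame_le`), (QE) strengthens and (QU)/(QH) weaken as the filling tameness decreases
  (`CoolMoatSlavedFillingP.of_tame_le`, `TubeCriticalUniquenessP.anti_tame/anti_dm/anti_level`, `NearHessianFloorP.anti_tame/anti_dm`).  ★ THE WINDOW LEMMA
  `mildCoolMoatCorePG_of_level_le_tame` (+ clamped form): at `ϑp ≤ ϑ`, `0 ≤ rm` the mild door is TRIVIALLY TRUE (the container lies in its own `rm`-core); with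
  `HotSparseBPG.of_le` ([WHSᵇ](ϑp) is [HSᵇ] or stronger for `ϑp ≤ tameRadius`) the amplitude cut of part YG has content ONLY for `tameRadius < ϑp`.  CONSEQUENCE
  (the structural finding of g67): the joint `(ϑp, ϑf)` dial has an EMPTY WINDOW against the crude two-ended budget `ϑp + ϑf ≲ 1/36` of row 1217 (`ϑp > 1/20 > 1/36`
  is forced) — the symmetric certificate (QH)(dm = 1/2) is not crude-certifiable at ANY dial setting, and the sizing row `(ϑp, ϑf) = (1/20, 1/40)` is degenerate
  (door trivially true, wild leaf undivided).  The way out is to stop certifying at the mild end: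
* **YM-2 (QWᶠ) «FarTwinGapP ϑ ϑp q ρ rm dm rb aHi Λ θ s» (NEW, typed; GENERIC side).**  The binders of (QU) verbatim + «the pair is FAR: `∃ i, rb < dist (xf i) (y i)`»
  ⟹ `clampedEnergy (S ∖ core) y < clampedEnergy (S ∖ core) xf`: a far tame critical twin lies STRICTLY BELOW the core — zeroth order, no Hessian.  PROVED:
  (QU)(dm) ⇒ (QWᶠ)(dm, rb ≥ 0) (`farTwinGapP_of_uniqueness`), (QC)(dm, κ > 0) ⇒ (QWᶠ) (`farTwinGapP_of_convexity`), vacuous at `dm ≤ rb` (`farTwinGapP_of_dm_le`),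
  dials `FarTwinGapP.of_rb_le/anti_tame/anti_dm/anti_level`.
* **YM-3 ★ THE TUBE-CUT GLUE (PROVED)** `mildCoolMoatClampedCoreP_of_slavedFilling_near_far`: [MCMCᶜ](ϑc, ϑ, ϑp) ⟸ (QE)(ϑc, ϑf, ϑp, dm) ∧ (QU)(ϑf, ϑp, dm := rb) ∧
  (QWᶠ)(ϑf, ϑp, dm, rb) for `ϑf ≤ ϑ`, `0 ≤ ρ` — SPECIAL = NEAR pairs (every site within `rb`: rigidity in a THIN tube around the TAME end, where every configuration
  inherits `y`'s gentleness, Born budget `ϑf/4 + 2·rb` INDEPENDENT of the mild amplitude `ϑp`), GENERIC = FAR pairs (excluded by the energy gap against the door's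
  own minimality `IsGrandClampedMin.isClampedMin` — a hypothesis (QU)(1/2) never spent), EXHAUSTION = `by_cases ∀ i, dist ≤ rb`.  Dial-free corollary
  `mildCoolMoatClampedCoreP_of_slavedFilling_uniqueness` ((QE)(ϑf) ∧ (QU)(ϑf, dm) ⇒ [MCMCᶜ](ϑ), `rb := dm`).
* **YM-4 THE NEAR CERTIFICATE FORM (PROVED from part YL + (TM))** `tubeCriticalUniquenessP_geom_of_hessianFloor`: (QU)(ϑf, ϑp, rb) ⟸ (QH)(ϑf, ϑp, rb, R = 41, cN) for
  ANY `cN > 3/500`, ANY `rb ≤ 1/2`, at the docket geometry; instance `nearTube_dial_of_hessianFloor` at `(ϑf, ϑp, rb) = (1/100, 1/10, 1/500)`.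
* **YM-5 THE TUBE DOCKET** `MildTubeDocket ϑm ra ϑp ϑf rb` := (QE)(ϑm, ϑf, ϑp, dm = 1/2) ∧ (QU)(ϑf, ϑp, rb) ∧ (QWᶠ)(ϑf, ϑp, 1/2, rb) ∧ [MSSHSᵇ](ϑp) ∧ [MBSHSᵇ](ϑp);
  PROVED: the mild door from it at ANY mild level (`mildCoolMoatCorePG_of_mildTubeDocket`), `MildColdSereneDocket` at `ϑp = 1/10`, dials, the B-chain generic in `ϑp`
  (`bareHotSparseBPG_of_mildTube_wild_tameBallIncoherence`), ★ COLUMN `_16XH28BN` (= `_16XH28B` with the mild package and the wild leaf [WHSᵇ](ϑp) under ONE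
  `∃ ϑm ra ϑp ϑf rb ϑ₁ ω₁`), and the record witnesses `mildTubeDocket_of_record_leaves` ((QE) ∧ (QU)(1/2) ⇒ the tube docket at `(1/10, tameRadius, rb)` for every
  `0 ≤ rb ≤ 1/2`), `farTwinGapP_record_of_variational`, `mildTubeDocket_of_hessianFloor`.

TARGET ⟸ PIECES (tags).  [MCMCᶜ](ϑm, tameRadius, ϑp) ⟸ (QE)(ϑm, ϑf, ϑp) [existence; STRONGER than the record's (QE)(tameRadius) as `ϑf < tameRadius` — the price of
the cut, paid in the FREE moat dial `ϑm` (`∃ ϑm`, colder is weaker: `CoolMoatSlavedFillingP.of_moat_le`); PERTURBATIVE in the data; ATTACKABLE-M (implicit function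
about the charted lattice with `ϑm`-cold Dirichlet data)] ∧ (QU)(ϑf, ϑp, rb) [SPECIAL; WEAKER than the record leaf (`anti_dm`); ATTACKABLE·CERT via (QH)(rb)
(YM-4), a `ϑp`-FREE small-strain Born comparison: crude loss `21·(ϑf/4 + 2rb) ≈ 0.14` at `(1/100, 1/500)` against the need `λ_D(R = 41)·(1 − loss) ≥ 2cN > 0.012`;
INSTRUMENTABLE «NearBorn»] ∧ (QWᶠ)(ϑf, ϑp, 1/2, rb) [GENERIC; NEW; WEAKER than the record leaf and than (QC) (two PROVED implications); UNDECIDED · TRUE-type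
expected · INSTRUMENTABLE «TwinScan»: KILL = a `ϑp`-mild Nash core `xf` and a `ϑf`-tame clamped-critical filling `y` within sitewise `1/2`, `d∞ > rb`,
`E(xf) ≤ E(y)`].  WHY EACH PIECE IS STRICTLY WEAKER: (QU)(rb) and (QWᶠ)(1/2, rb) each follow from (QU)(1/2) (PROVED) and JOINTLY do NOT give it back — near ∧ far
say nothing about far pairs ABOVE the core's energy; the slack is exactly the door's minimality, so the pair is weaker than the record leaf AS A PAIR; (QE)(ϑf) is
the one strengthened piece and sits on the perturbative (data) axis with its own free dial.  No EQUIV step.  WHY THIS IS NOVEL: no earlier node of the docket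
anchors the rigidity certificate at the TAME end or spends clamped minimality against far twins — g66's near/far split is radial IN SPACE (near shells / far tail
of one Hessian), this one is near/far IN CONFIGURATION DISTANCE (the sup-norm tube), and it is what frees the certificate from the mild amplitude.
INSTRUMENTS (census ASKs, memo NODE-g67-TubeCut.md): «TwinScan(rb = 1/500)» (d∞(xf, y) over sampled mild Nash cores; second clamped equilibria within `1/2` of `y`
with `(d∞, ΔE)`; decides (QWᶠ) and sizes the near/far census) and «NearBorn(ϑf, rb) ∈ {(1/100, 1/500), (1/40, 1/1000)}» (λ_min of the clamped near Hessian over the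
`rb`-tube and its drift constant; decides whether (QH)(rb) is interval-certifiable).  0 sorry; standard axioms; 2 `def : Prop` (tag at landing) + 30 theorems.
-/

noncomputable section

open scoped BigOperators Classical
open MeasureTheory Set Metric Filter Topology
open Summit.AtomisticToContinuum.Crystallization.Theorems.ChartedPlanarOrderRigidityDoor (E3 eStar atomsIn IsEStarGSC siteEnergy VisibleGap PertRegime)
open Summit.AtomisticToContinuum.Crystallization.Theorems.ChartedPlanarOrderDensityDichotomy (μS IsSep nK nK_nonneg)
open Summit.AtomisticToContinuum.Crystallization.Theorems.ChartedPlanarOrderCleanScaleP (IsCleanP IsDoorSetP)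
open Summit.AtomisticToContinuum.Crystallization.Theorems.ChartedPlanarOrderMesoCut (LayeredHom EnvClose)
open Summit.AtomisticToContinuum.Crystallization.Theorems.ChartedPlanarOrderDoorLayered (atomsIn_subset sq_le_finsum_mem PeriodicBulkGapDoor)
open Summit.AtomisticToContinuum.Crystallization.Theorems.ChartedPlanarOrderDoorLayeredOsc (IsTwoShellAffineGood)
open Literature.MathematicalPhysics.StatisticalMechanics (card_le_of_separated_of_dist_le lennardJones interactionEnergy)

namespace Summit.AtomisticToContinuum.Crystallization.Theorems.ChartedZeroExcessLayeredLatticeLiouville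

/-! ## Part YM «TubeCut» (lens-2 g67): the OUTPUT-TAMENESS DIAL `ϑ` of the variational split and the NEAR / FAR CUT OF THE TWIN PAIR anchored at the tame end -/

section TubeCut

/-! ### YM-1  The output-tameness dial `ϑ` (PROVED): the doors WEAKEN, the existence half (QE) STRENGTHENS, the rigidity leaves (QU) / (QH) WEAKEN as the
filling tameness decreases; the WINDOW LEMMA: at `ϑp ≤ ϑ` the mild door is TRIVIALLY TRUE (the amplitude cut has content only for `ϑp > ϑ`) -/

/-- **DIAL (PROVED): [MCMC] WEAKENS as the output tameness `ϑ` grows** (`ϑ ≤ ϑ'`: a `ϑ`-tame container is `ϑ'`-tame). [this file, g67] -/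
theorem MildCoolMoatCorePG.of_tame_le {ϑc ϑ ϑ' ϑp r q rsh rm aHi Λ θ s : ℝ} (h : ϑ ≤ ϑ')
    (hC : MildCoolMoatCorePG ϑc ϑ ϑp r q rsh rm aHi Λ θ s) : MildCoolMoatCorePG ϑc ϑ' ϑp r q rsh rm aHi Λ θ s :=
  fun δ hδ a ha S hS hgood L w hLw x₀ K hKS hKq hmild hcool =>
    IsTameOn.mono h subset_rfl (hC δ hδ a ha S hS hgood L w hLw x₀ K hKS hKq hmild hcool)

/-- **DIAL (PROVED): [MCMCᶜ] WEAKENS as the output tameness `ϑ` grows.** [this file, g67] -/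
theorem MildCoolMoatClampedCoreP.of_tame_le {ϑc ϑ ϑ' ϑp r q rsh ρ rm aHi Λ θ s : ℝ} (h : ϑ ≤ ϑ')
    (hC : MildCoolMoatClampedCoreP ϑc ϑ ϑp r q rsh ρ rm aHi Λ θ s) : MildCoolMoatClampedCoreP ϑc ϑ' ϑp r q rsh ρ rm aHi Λ θ s :=
  fun δ hδ a ha S hS hsum hgood L w hLw x₀ K hKS hKq hmild hcool hmin =>
    IsTameOn.mono h subset_rfl (hC δ hδ a ha S hS hsum hgood L w hLw x₀ K hKS hKq hmild hcool hmin)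

/-- ★ **THE WINDOW LEMMA (PROVED): at `ϑp ≤ ϑ` (and `0 ≤ rm`) the mild door [MCMC] is TRIVIALLY TRUE** — the container lies in its own `rm`-core, so a `ϑp`-tame core
is already a `ϑ`-tame container.  Together with `HotSparseBPG.of_le` ([WHSᵇ](ϑp) ⇒ [HSᵇ](ϑ) for `ϑp ≤ ϑ`) this says the amplitude cut of part YG has CONTENT ONLY IN
THE WINDOW `ϑ < ϑp`: the mild level can never be dialled below the hot level `tameRadius`. [this file, g67] -/
theorem mildCoolMoatCorePG_of_level_le_tame {ϑc ϑ ϑp r q rsh rm aHi Λ θ s : ℝ} (h : ϑp ≤ ϑ) (hrm : 0 ≤ rm) :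
    MildCoolMoatCorePG ϑc ϑ ϑp r q rsh rm aHi Λ θ s :=
  fun δ hδ a ha S hS hgood L w hLw x₀ K hKS hKq hmild hcool => by
  refine IsTameOn.mono h (fun k hk => ?_) hmild
  have hk' : k ∈ coreOf S K rm := ⟨hKS hk, k, hk, by rw [dist_self]; exact hrm⟩
  exact hk'

/-- **THE WINDOW LEMMA, clamped form (PROVED)**: [MCMCᶜ] is trivially true at `ϑp ≤ ϑ`, `0 ≤ rm`. [this file, g67] -/
theorem mildCoolMoatClampedCoreP_of_level_le_tame {ϑc ϑ ϑp r q rsh ρ rm aHi Λ θ s : ℝ} (h : ϑp ≤ ϑ) (hrm : 0 ≤ rm) :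
    MildCoolMoatClampedCoreP ϑc ϑ ϑp r q rsh ρ rm aHi Λ θ s :=
  fun δ hδ a ha S hS hsum hgood L w hLw x₀ K hKS hKq hmild hcool hmin => by
  refine IsTameOn.mono h (fun k hk => ?_) hmild
  have hk' : k ∈ coreOf S K rm := ⟨hKS hk, k, hk, by rw [dist_self]; exact hrm⟩
  exact hk'

/-- **DIAL (PROVED): (QE) is STRONGER at a smaller output tameness** — a `ϑ`-tame slaved filling is `ϑ'`-tame for `ϑ ≤ ϑ'`. [this file, g67] -/
theorem CoolMoatSlavedFillingP.of_tame_le {ϑc ϑ ϑ' ϑp r q rsh ρ rm dm aHi Λ θ s : ℝ} (h : ϑ ≤ ϑ')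
    (hE : CoolMoatSlavedFillingP ϑc ϑ ϑp r q rsh ρ rm dm aHi Λ θ s) : CoolMoatSlavedFillingP ϑc ϑ' ϑp r q rsh ρ rm dm aHi Λ θ s := by
  intro δ hδ a ha S hS hsum hgood L w hLw x₀ K hKS hKq hmild hcool n xf hxf hrange
  obtain ⟨y, hyinj, hydisj, hnear, hcrit, htame⟩ := hE δ hδ a ha S hS hsum hgood L w hLw x₀ K hKS hKq hmild hcool n xf hxf hrange
  exact ⟨y, hyinj, hydisj, hnear, hcrit, fun i => (htame i).mono h⟩

/-- **DIAL (PROVED): (QE) is WEAKER at a larger matching radius** (`dm ≤ dm'`). [this file, g67] -/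
theorem CoolMoatSlavedFillingP.of_dm_le {ϑc ϑ ϑp r q rsh ρ rm dm dm' aHi Λ θ s : ℝ} (h : dm ≤ dm')
    (hE : CoolMoatSlavedFillingP ϑc ϑ ϑp r q rsh ρ rm dm aHi Λ θ s) : CoolMoatSlavedFillingP ϑc ϑ ϑp r q rsh ρ rm dm' aHi Λ θ s := by
  intro δ hδ a ha S hS hsum hgood L w hLw x₀ K hKS hKq hmild hcool n xf hxf hrange
  obtain ⟨y, hyinj, hydisj, hnear, hcrit, htame⟩ := hE δ hδ a ha S hS hsum hgood L w hLw x₀ K hKS hKq hmild hcool n xf hxf hrange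
  exact ⟨y, hyinj, hydisj, fun i => (hnear i).trans h, hcrit, htame⟩

/-- **ANTI-DIAL (PROVED): (QU) is WEAKER at a smaller filling tameness** (`ϑ ≤ ϑ'`: fewer fillings qualify). [this file, g67] -/
theorem TubeCriticalUniquenessP.anti_tame {ϑ ϑ' ϑp q ρ rm dm aHi Λ θ s : ℝ} (h : ϑ ≤ ϑ')
    (hU : TubeCriticalUniquenessP ϑ' ϑp q ρ rm dm aHi Λ θ s) : TubeCriticalUniquenessP ϑ ϑp q ρ rm dm aHi Λ θ s :=
  fun δ hδ a ha S hS hsum hgood L w hLw x₀ K hKS hKq hmild n xf hxf hrange y hnear hyinj hydisj hcrit htame =>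
    hU δ hδ a ha S hS hsum hgood L w hLw x₀ K hKS hKq hmild n xf hxf hrange y hnear hyinj hydisj hcrit fun i => (htame i).mono h

/-- **ANTI-DIAL (PROVED): (QU) is WEAKER in a thinner tube** (`dm ≤ dm'`). [this file, g67] -/
theorem TubeCriticalUniquenessP.anti_dm {ϑ ϑp q ρ rm dm dm' aHi Λ θ s : ℝ} (h : dm ≤ dm')
    (hU : TubeCriticalUniquenessP ϑ ϑp q ρ rm dm' aHi Λ θ s) : TubeCriticalUniquenessP ϑ ϑp q ρ rm dm aHi Λ θ s :=
  fun δ hδ a ha S hS hsum hgood L w hLw x₀ K hKS hKq hmild n xf hxf hrange y hnear hyinj hydisj hcrit htame =>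
    hU δ hδ a ha S hS hsum hgood L w hLw x₀ K hKS hKq hmild n xf hxf hrange y (fun i => (hnear i).trans h) hyinj hydisj hcrit htame

/-- **ANTI-DIAL (PROVED): (QU) is WEAKER at a smaller mild level** (`ϑp ≤ ϑp'`: the `ϑp`-tame core hypothesis is stronger). [this file, g67] -/
theorem TubeCriticalUniquenessP.anti_level {ϑ ϑp ϑp' q ρ rm dm aHi Λ θ s : ℝ} (h : ϑp ≤ ϑp')
    (hU : TubeCriticalUniquenessP ϑ ϑp' q ρ rm dm aHi Λ θ s) : TubeCriticalUniquenessP ϑ ϑp q ρ rm dm aHi Λ θ s :=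
  fun δ hδ a ha S hS hsum hgood L w hLw x₀ K hKS hKq hmild n xf hxf hrange y hnear hyinj hydisj hcrit htame =>
    hU δ hδ a ha S hS hsum hgood L w hLw x₀ K hKS hKq (IsTameOn.mono h subset_rfl hmild) n xf hxf hrange y hnear hyinj hydisj hcrit htame

/-- **ANTI-DIAL (PROVED): (QH) is WEAKER at a smaller filling tameness.** [this file, g67] -/
theorem NearHessianFloorP.anti_tame {ϑ ϑ' ϑp q ρ rm dm R cN aHi Λ θ s : ℝ} (h : ϑ ≤ ϑ')
    (hN : NearHessianFloorP ϑ' ϑp q ρ rm dm R cN aHi Λ θ s) : NearHessianFloorP ϑ ϑp q ρ rm dm R cN aHi Λ θ s :=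
  fun δ hδ a ha S hS hsum hgood L w hLw x₀ K hKS hKq hmild n xf hxf hrange y hnear hyinj hydisj hcrit htame =>
    hN δ hδ a ha S hS hsum hgood L w hLw x₀ K hKS hKq hmild n xf hxf hrange y hnear hyinj hydisj hcrit fun i => (htame i).mono h

/-- **ANTI-DIAL (PROVED): (QH) is WEAKER in a thinner tube** (`dm ≤ dm'`). [this file, g67] -/
theorem NearHessianFloorP.anti_dm {ϑ ϑp q ρ rm dm dm' R cN aHi Λ θ s : ℝ} (h : dm ≤ dm')
    (hN : NearHessianFloorP ϑ ϑp q ρ rm dm' R cN aHi Λ θ s) : NearHessianFloorP ϑ ϑp q ρ rm dm R cN aHi Λ θ s :=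
  fun δ hδ a ha S hS hsum hgood L w hLw x₀ K hKS hKq hmild n xf hxf hrange y hnear hyinj hydisj hcrit htame =>
    hN δ hδ a ha S hS hsum hgood L w hLw x₀ K hKS hKq hmild n xf hxf hrange y (fun i => (hnear i).trans h) hyinj hydisj hcrit htame

/-! ### YM-2  (QWᶠ) «FarTwinGapP» — the GENERIC side of the tube cut: a far tame critical twin is ENERGETICALLY STRICTLY BELOW the core enumeration -/

/-- ★★★ **(QWᶠ) «FarTwinGapP ϑ ϑp q ρ rm dm rb aHi Λ θ s» — THE FAR-TWIN ENERGY GAP.**  The binders of (QU) `TubeCriticalUniquenessP` VERBATIM (θ-good `aHi`-door set `S`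
with summable pair sums, equilibrium chart, centre, container `K ⊆ S ∩ B̄(x₀, q)` with `ϑp`-tame `rm`-core, an injective enumeration `xf` of the `ρ`-core, a filling `y`
of the same count matched to `xf` within `dm`, injective, off the exterior, CLAMPED-CRITICAL and `ϑ`-tame at every site) plus ONE more hypothesis: the pair is FAR —
some site is displaced by MORE than `rb` (`∃ i, rb < dist (xf i) (y i)`).  Conclusion: `clampedEnergy (S ∖ core) y < clampedEnergy (S ∖ core) xf` — the tame critical
filling is STRICTLY BELOW the core in the frozen field.  THE GENERIC HALF of the tube cut: in the door scenario the core `xf` is a clamped MINIMISER, so a far pair is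
impossible and only NEAR pairs (sitewise within `rb`) need rigidity — which is (QU) at `dm := rb`, a thin tube around the TAME end where the Born floor is
perturbative (budget `ϑ/4 + 2·rb` in strain units, INDEPENDENT of the mild amplitude `ϑp`).  ZEROTH-ORDER (no Hessian, no convexity): it forbids only far
twins AT OR BELOW the energy of `y`'s partner, not metastable far twins above it.  WEAKER than (QU)(dm) (`farTwinGapP_of_uniqueness`, `0 ≤ rb`) and than
(QC)(dm, κ > 0) (`farTwinGapP_of_convexity`); WEAKENS as `rb` grows (`FarTwinGapP.of_rb_le`), as `ϑ`, `ϑp`, `dm` decrease; VACUOUS at `dm ≤ rb`.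
ANALYTIC · LOCAL · FINITE · UNDECIDED · TRUE-type expected (the `ϑ`-tame critical filling is the local ground state of the clamped ball; a defect-free Nash core
differing from it by `> rb` somewhere at equal or lower energy would be a degenerate second near-crystalline equilibrium within half a spacing — none known for
Lennard-Jones under clamped near-perfect data) · NON-PERTURBATIVE as a theorem (an energy landscape statement on the sup-norm annulus `rb < d∞ ≤ dm`) ·
INSTRUMENTABLE («TwinScan(rb)»: second clamped equilibria within sitewise `dm` of the slaved tame filling of sampled mild cores, by eigenvector-following /
dimer searches; report `(d∞, ΔE)`; KILL iff `ΔE ≤ 0` at `d∞ > rb`).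
Why it might fail: a symmetric pair of buckled near-crystalline equilibria (double well of a soft clamped mode) with buckling amplitude `> rb` and equal energies —
requires a clamped phonon of the `ϑ`-tame filling softer than the near-tube certificate allows, i.e. it is excluded exactly where (QU)(rb) ⟸ (QH)(rb) is certified
with room; a genuinely different defect-free equilibrium (e.g. a sheared-layer state) within sitewise `1/2` at lower energy would refute it and the door with it.
Sources: part YL ((QU)); part YI ((QC), the variational glue); part UH (`IsClampedMin`); E–Ming, Arch. Ration. Mech. Anal. 183 (2007) 241 §2; Wallace,
Thermodynamics of Crystals (1972) (Born stability); Braun–Schmidt, Calc. Var. PDE 55 (2016) (arXiv:1604.00197: tube uniqueness by a quantitative IFT — the NEAR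
side only, «no uniqueness in general»); CRITIC-LEDGER rows 1208 (b⁗), 1217. [this file, g67] -/
def FarTwinGapP (ϑ ϑp q ρ rm dm rb aHi Λ θ s : ℝ) : Prop :=
  ∀ δ : ℝ, 0 < δ → ∀ a : ℝ, 0 < a →
    ∀ S : Set E3, IsDoorSetP aHi δ S → (∀ z : E3, Summable fun y : S => lennardJones (dist z (y : E3))) →
      (∀ p ∈ S, IsTwoShellAffineGood θ S p) →
        ∀ (L : E3 ≃L[ℝ] E3) (w : ℤ → E3), IsEquilChart a s Λ L w →
          ∀ (x₀ : E3) (K : Set E3), K ⊆ S → (∀ k ∈ K, dist k x₀ ≤ q) →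
            IsTameOn ϑp S (LayeredHom (L : E3 →L[ℝ] E3) w) (coreOf S K rm) →
              ∀ (n : ℕ) (xf : Fin n → E3), Function.Injective xf → Set.range xf = coreOf S K ρ →
                ∀ y : Fin n → E3, (∀ i, dist (xf i) (y i) ≤ dm) → Function.Injective y → Disjoint (Set.range y) (S \ coreOf S K ρ) →
                  HasFDerivAt (fun z : Fin n → E3 => clampedEnergy (S \ coreOf S K ρ) z) (0 : (Fin n → E3) →L[ℝ] ℝ) y →
                    (∀ i, IsTameStar ϑ ((S \ coreOf S K ρ) ∪ Set.range y) (LayeredHom (L : E3 →L[ℝ] E3) w) (y i)) →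
                      (∃ i, rb < dist (xf i) (y i)) →
                        clampedEnergy (S \ coreOf S K ρ) y < clampedEnergy (S \ coreOf S K ρ) xf

/-- ★ **(QU)(dm) ⇒ (QWᶠ)(dm, rb) for every `rb ≥ 0` (PROVED)** — under uniqueness there is no far pair at all. WEAKER than the leaf of record. [this file, g67] -/
theorem farTwinGapP_of_uniqueness {ϑ ϑp q ρ rm dm rb aHi Λ θ s : ℝ} (hrb : 0 ≤ rb) (hU : TubeCriticalUniquenessP ϑ ϑp q ρ rm dm aHi Λ θ s) :
    FarTwinGapP ϑ ϑp q ρ rm dm rb aHi Λ θ s := by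
  intro δ hδ a ha S hS hsum hgood L w hLw x₀ K hKS hKq hmild n xf hxf hrange y hnear hyinj hydisj hcrit htame hfar
  obtain ⟨i, hi⟩ := hfar
  have hyx := hU δ hδ a ha S hS hsum hgood L w hLw x₀ K hKS hKq hmild n xf hxf hrange y hnear hyinj hydisj hcrit htame
  rw [hyx, dist_self] at hi
  exact absurd hi (not_lt.2 hrb)

/-- ★ **(QC)(dm, κ > 0) ⇒ (QWᶠ)(dm, rb) for every `rb ≥ 0` (PROVED)** — strong convexity about the critical filling puts every far core strictly above it. WEAKER than
part YI's amplitude leaf too. [this file, g67] -/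
theorem farTwinGapP_of_convexity {ϑ ϑp q ρ rm dm κ rb aHi Λ θ s : ℝ} (hκ : 0 < κ) (hrb : 0 ≤ rb)
    (hC : MildClampedConvexityP ϑ ϑp q ρ rm dm κ aHi Λ θ s) : FarTwinGapP ϑ ϑp q ρ rm dm rb aHi Λ θ s := by
  intro δ hδ a ha S hS hsum hgood L w hLw x₀ K hKS hKq hmild n xf hxf hrange y hnear hyinj hydisj hcrit htame hfar
  obtain ⟨i, hi⟩ := hfar
  have key := hC δ hδ a ha S hS hsum hgood L w hLw x₀ K hKS hKq hmild n xf hxf hrange y hnear hyinj hydisj hcrit htame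
  have hpos : 0 < dist (xf i) (y i) ^ 2 := by
    have h0 : 0 < dist (xf i) (y i) := hrb.trans_lt hi
    positivity
  have hle : dist (xf i) (y i) ^ 2 ≤ ∑ j, dist (xf j) (y j) ^ 2 :=
    Finset.single_le_sum (f := fun j => dist (xf j) (y j) ^ 2) (fun j _ => by positivity) (Finset.mem_univ i)
  have hprod : 0 < κ * ∑ j, dist (xf j) (y j) ^ 2 := mul_pos hκ (hpos.trans_le hle)
  linarith

/-- **(QWᶠ) is VACUOUS when the tube is not wider than the near radius (PROVED)**: `dm ≤ rb`. [this file, g67] -/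
theorem farTwinGapP_of_dm_le {ϑ ϑp q ρ rm dm rb aHi Λ θ s : ℝ} (h : dm ≤ rb) : FarTwinGapP ϑ ϑp q ρ rm dm rb aHi Λ θ s := by
  intro δ hδ a ha S hS hsum hgood L w hLw x₀ K hKS hKq hmild n xf hxf hrange y hnear hyinj hydisj hcrit htame hfar
  obtain ⟨i, hi⟩ := hfar
  exact absurd ((hnear i).trans h) (not_le.2 hi)

/-- **DIAL (PROVED): (QWᶠ) WEAKENS as the near radius `rb` grows** (fewer pairs are far). [this file, g67] -/
theorem FarTwinGapP.of_rb_le {ϑ ϑp q ρ rm dm rb rb' aHi Λ θ s : ℝ} (h : rb ≤ rb') (hF : FarTwinGapP ϑ ϑp q ρ rm dm rb aHi Λ θ s) :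
    FarTwinGapP ϑ ϑp q ρ rm dm rb' aHi Λ θ s :=
  fun δ hδ a ha S hS hsum hgood L w hLw x₀ K hKS hKq hmild n xf hxf hrange y hnear hyinj hydisj hcrit htame hfar =>
    hF δ hδ a ha S hS hsum hgood L w hLw x₀ K hKS hKq hmild n xf hxf hrange y hnear hyinj hydisj hcrit htame (hfar.imp fun _ hi => h.trans_lt hi)

/-- **ANTI-DIAL (PROVED): (QWᶠ) is WEAKER at a smaller filling tameness.** [this file, g67] -/
theorem FarTwinGapP.anti_tame {ϑ ϑ' ϑp q ρ rm dm rb aHi Λ θ s : ℝ} (h : ϑ ≤ ϑ') (hF : FarTwinGapP ϑ' ϑp q ρ rm dm rb aHi Λ θ s) :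
    FarTwinGapP ϑ ϑp q ρ rm dm rb aHi Λ θ s :=
  fun δ hδ a ha S hS hsum hgood L w hLw x₀ K hKS hKq hmild n xf hxf hrange y hnear hyinj hydisj hcrit htame hfar =>
    hF δ hδ a ha S hS hsum hgood L w hLw x₀ K hKS hKq hmild n xf hxf hrange y hnear hyinj hydisj hcrit (fun i => (htame i).mono h) hfar

/-- **ANTI-DIAL (PROVED): (QWᶠ) is WEAKER in a thinner tube** (`dm ≤ dm'`). [this file, g67] -/
theorem FarTwinGapP.anti_dm {ϑ ϑp q ρ rm dm dm' rb aHi Λ θ s : ℝ} (h : dm ≤ dm') (hF : FarTwinGapP ϑ ϑp q ρ rm dm' rb aHi Λ θ s) :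
    FarTwinGapP ϑ ϑp q ρ rm dm rb aHi Λ θ s :=
  fun δ hδ a ha S hS hsum hgood L w hLw x₀ K hKS hKq hmild n xf hxf hrange y hnear hyinj hydisj hcrit htame hfar =>
    hF δ hδ a ha S hS hsum hgood L w hLw x₀ K hKS hKq hmild n xf hxf hrange y (fun i => (hnear i).trans h) hyinj hydisj hcrit htame hfar

/-- **ANTI-DIAL (PROVED): (QWᶠ) is WEAKER at a smaller mild level** (`ϑp ≤ ϑp'`). [this file, g67] -/
theorem FarTwinGapP.anti_level {ϑ ϑp ϑp' q ρ rm dm rb aHi Λ θ s : ℝ} (h : ϑp ≤ ϑp') (hF : FarTwinGapP ϑ ϑp' q ρ rm dm rb aHi Λ θ s) :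
    FarTwinGapP ϑ ϑp q ρ rm dm rb aHi Λ θ s :=
  fun δ hδ a ha S hS hsum hgood L w hLw x₀ K hKS hKq hmild n xf hxf hrange y hnear hyinj hydisj hcrit htame hfar =>
    hF δ hδ a ha S hS hsum hgood L w hLw x₀ K hKS hKq (IsTameOn.mono h subset_rfl hmild) n xf hxf hrange y hnear hyinj hydisj hcrit htame hfar

/-! ### YM-3  THE TUBE-CUT GLUE (PROVED): [MCMCᶜ](ϑ) ⟸ (QE)(ϑf) ∧ (QU)(ϑf, dm := rb) ∧ (QWᶠ)(ϑf, dm, rb), `ϑf ≤ ϑ` -/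

/-- ★★★ **THE TUBE-CUT GLUE (PROVED): (QE)(ϑc, ϑf, dm) ∧ (QU)(ϑf, rb) ∧ (QWᶠ)(ϑf, dm, rb) ⇒ [MCMCᶜ](ϑc, ϑ)** for `ϑf ≤ ϑ`, `0 ≤ ρ`.  Enumerate the finite `ρ`-core as
`xf`; (QE) gives the `ϑf`-tame clamped-critical filling `y` matched within `dm`.  NEAR CASE (every site within `rb`): (QU) at `dm := rb` gives `y = xf`.  FAR CASE
(some site beyond `rb`): (QWᶠ) gives `E(y) < E(xf)` while canonical clamped minimality of the core (`IsGrandClampedMin.isClampedMin`, from the door) gives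
`E(xf) ≤ E(y)` — contradiction.  Hence `y = xf`, the glued configuration is `S`, and every site of `K ⊆ core` carries a `ϑf`-tame, hence `ϑ`-tame, star.
The mild amplitude `ϑp` is untouched; the filling tameness `ϑf` and the near radius `rb` are FREE DIALS of the discharge. [this file, g67] -/
theorem mildCoolMoatClampedCoreP_of_slavedFilling_near_far {ϑc ϑ ϑf ϑp r q rsh ρ rm dm rb aHi Λ θ s : ℝ} (hf : ϑf ≤ ϑ) (hρ : 0 ≤ ρ)
    (hE : CoolMoatSlavedFillingP ϑc ϑf ϑp r q rsh ρ rm dm aHi Λ θ s) (hN : TubeCriticalUniquenessP ϑf ϑp q ρ rm rb aHi Λ θ s)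
    (hF : FarTwinGapP ϑf ϑp q ρ rm dm rb aHi Λ θ s) : MildCoolMoatClampedCoreP ϑc ϑ ϑp r q rsh ρ rm aHi Λ θ s := by
  intro δ hδ a ha S hS hsum hgood L w hLw x₀ K hKS hKq hmild hcool hmin
  have hKf : K.Finite :=
    (Literature.Probability.Process.LocalConfig.finite_inter_of_separated hδ hS.2.1 (isCompact_closedBall x₀ q)).subset
      fun k hk => ⟨mem_closedBall.2 (hKq k hk), hKS hk⟩
  obtain ⟨n, f, hf'⟩ := (coreOf_finite hδ hS.2.1 hKf ρ).fin_embedding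
  obtain ⟨y, hyinj, hydisj, hnear, hcrit, htame⟩ := hE δ hδ a ha S hS hsum hgood L w hLw x₀ K hKS hKq hmild hcool n f f.injective hf'
  have hyf : y = ⇑f := by
    by_cases hnb : ∀ i, dist (f i) (y i) ≤ rb
    · exact hN δ hδ a ha S hS hsum hgood L w hLw x₀ K hKS hKq hmild n f f.injective hf' y hnb hyinj hydisj hcrit htame
    · push Not at hnb
      have hlt := hF δ hδ a ha S hS hsum hgood L w hLw x₀ K hKS hKq hmild n f f.injective hf' y hnear hyinj hydisj hcrit htame hnb
      have hle := hmin.isClampedMin n f f.injective hf' y hyinj hydisj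
      exact absurd hlt (not_lt.2 hle)
  have hglued : (S \ coreOf S K ρ) ∪ Set.range y = S := by
    rw [hyf, hf', sdiff_union_of_subset (coreOf_subset S K ρ)]
  intro k hk
  have hkcore : k ∈ coreOf S K ρ := ⟨hKS hk, k, hk, by rw [dist_self]; exact hρ⟩
  rw [← hf'] at hkcore
  obtain ⟨i, hi⟩ := hkcore
  have ht := (htame i).mono hf
  rw [hglued, hyf] at ht
  rw [← hi]
  exact ht

/-- ★★ **THE DIAL-FREE FORM (PROVED): (QE)(ϑc, ϑf, dm) ∧ (QU)(ϑf, dm) ⇒ [MCMCᶜ](ϑc, ϑ)**, `ϑf ≤ ϑ`, `0 ≤ ρ` — the near radius taken equal to the tube (`rb := dm`,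
the far leaf vacuous): the variational split of part YI with the uniqueness leaf of record (part YL) in place of (QC), at ANY output tameness `ϑf ≤ ϑ`. [this file, g67] -/
theorem mildCoolMoatClampedCoreP_of_slavedFilling_uniqueness {ϑc ϑ ϑf ϑp r q rsh ρ rm dm aHi Λ θ s : ℝ} (hf : ϑf ≤ ϑ) (hρ : 0 ≤ ρ)
    (hE : CoolMoatSlavedFillingP ϑc ϑf ϑp r q rsh ρ rm dm aHi Λ θ s) (hU : TubeCriticalUniquenessP ϑf ϑp q ρ rm dm aHi Λ θ s) :
    MildCoolMoatClampedCoreP ϑc ϑ ϑp r q rsh ρ rm aHi Λ θ s :=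
  mildCoolMoatClampedCoreP_of_slavedFilling_near_far hf hρ hE hU (farTwinGapP_of_dm_le le_rfl)

/-! ### YM-4  The NEAR leaf's certificate form at the docket geometry, generic in the three dials `(ϑf, ϑp, rb)` (PROVED from part YL + (TM)) -/

/-- ★★ **(QU)(ϑf, ϑp, rb) ⟸ (QH)(ϑf, ϑp, rb, R = 41, cN) for ANY `cN > 3/500`, ANY `rb ≤ 1/2` (PROVED)** at the docket geometry `(q, ρ, rm) = (4, 16, 16)`,
`(aHi, Λ, θ, s) = (1, 2, 1/16, 1/50)`: part YL's two-sided rigidity with `(Rc, T) := (41/2, 1/4000)` and the landed tail moment `doorTailMomentP_record`.  THE HOME OF THE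
NEAR CERTIFICATE: inside the `rb`-tube around a `ϑf`-tame filling every configuration on a matched segment has bond strains `≲ ϑf/4 + 2·rb`, so at `(ϑf, rb) =
(1/100, 1/500)` the floor is a `≈ 0.65 %`-strain Born comparison about the chart lattice — INSIDE the crude multiplicative budget `≈ 0.7 %` of CRITIC-LEDGER row 1217,
and independent of the mild amplitude `ϑp`. [this file, g67] -/
theorem tubeCriticalUniquenessP_geom_of_hessianFloor {ϑf ϑp rb cN : ℝ} (hrb : rb ≤ 1 / 2) (hcN : 3 / 500 < cN)
    (hN : NearHessianFloorP ϑf ϑp 4 16 16 rb 41 cN 1 2 (1 / 16) (1 / 50)) : TubeCriticalUniquenessP ϑf ϑp 4 16 16 rb 1 2 (1 / 16) (1 / 50) :=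
  tubeCriticalUniquenessP_of_hessianFloor (Rc := 41 / 2) (T := 1 / 4000) (by linarith) (by norm_num) doorTailMomentP_record (by linarith) hN

/-- **THE PROPOSED DIAL SETTING (PROVED instance): (QU)(1/100, 1/10, rb = 1/500) ⟸ (QH)(1/100, 1/10, 1/500, 41, cN), `cN > 3/500`.** [this file, g67] -/
theorem nearTube_dial_of_hessianFloor {cN : ℝ} (hcN : 3 / 500 < cN)
    (hN : NearHessianFloorP (1 / 100) (1 / 10) 4 16 16 (1 / 500) 41 cN 1 2 (1 / 16) (1 / 50)) :
    TubeCriticalUniquenessP (1 / 100) (1 / 10) 4 16 16 (1 / 500) 1 2 (1 / 16) (1 / 50) :=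
  tubeCriticalUniquenessP_geom_of_hessianFloor (by norm_num) hcN hN

/-! ### YM-5  The TUBE DOCKET with its four dials `(ϑm, ra, ϑp, ϑf, rb)`, the mild door and B-chain from it at ANY mild level, the column `_16XH28BN`, record witnesses -/

/-- ★★ **THE MILD TUBE DOCKET `MildTubeDocket ϑm ra ϑp ϑf rb`** — `MildColdSereneDocket` with the mild door [MCMC] DISCHARGED by the tube cut: (QE)(ϑm, ϑf, ϑp, dm = 1/2)
existence of the `ϑf`-tame slaved critical filling, (QU)(ϑf, ϑp, rb) rigidity of the NEAR tube, (QWᶠ)(ϑf, ϑp, 1/2, rb) the FAR energy gap, and the two mild serene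
residual leaves at mild level `ϑp`, mild radius `24`.  Dials: moat temperature `ϑm` (free, `∃ ϑm`), serenity radius `ra ≥ 24`, mild amplitude `ϑp` (window
`tameRadius < ϑp`, price [WHSᵇ](ϑp)), filling tameness `ϑf ≤ tameRadius` ((QE) strengthens, (QU)/(QWᶠ) weaken as `ϑf ↓`), near radius `rb` ((QU) weakens, (QWᶠ)
strengthens as `rb ↓`). [this file, g67] -/
def MildTubeDocket (ϑm ra ϑp ϑf rb : ℝ) : Prop :=
  CoolMoatSlavedFillingP ϑm ϑf ϑp 8 4 12 16 16 (1 / 2) 1 2 (1 / 16) (1 / 50) ∧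
    TubeCriticalUniquenessP ϑf ϑp 4 16 16 rb 1 2 (1 / 16) (1 / 50) ∧
      FarTwinGapP ϑf ϑp 4 16 16 (1 / 2) rb 1 2 (1 / 16) (1 / 50) ∧
        MildSlenderSereneHotSparseBPG ϑm tameRadius 8 ra dressLevel dressLevel dressExponent 8 collarRadius clusterSize 4 32 8 ϑp 24 1 2 (1 / 16) (1 / 50) ∧
          MildBuriedSereneHotSparseBPG ϑm tameRadius 8 ra dressLevel dressLevel dressExponent 8 collarRadius clusterSize 8 ϑp 24 1 2 (1 / 16) (1 / 50)

/-- ★★ **TUBE DOCKET ⇒ THE MILD DOOR [MCMC](ϑm, tameRadius, ϑp) (PROVED)**, `ϑf ≤ tameRadius`. [this file, g67] -/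
theorem mildCoolMoatCorePG_of_mildTubeDocket {ϑm ra ϑp ϑf rb : ℝ} (hf : ϑf ≤ tameRadius) (hD : MildTubeDocket ϑm ra ϑp ϑf rb) :
    MildCoolMoatCorePG ϑm tameRadius ϑp 8 4 12 16 1 2 (1 / 16) (1 / 50) :=
  mildCoolMoatCorePG_of_mildClamped (mildCoolMoatClampedCoreP_of_slavedFilling_near_far hf (by norm_num) hD.1 hD.2.1 hD.2.2.1)

/-- **TUBE DOCKET at mild level `1/10` ⇒ `MildColdSereneDocket` (PROVED)**, `ϑf ≤ tameRadius`. [this file, g67] -/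
theorem mildColdSereneDocket_of_mildTubeDocket {ϑm ra ϑf rb : ℝ} (hf : ϑf ≤ tameRadius) (hD : MildTubeDocket ϑm ra (1 / 10) ϑf rb) :
    MildColdSereneDocket ϑm ra :=
  ⟨mildCoolMoatCorePG_of_mildTubeDocket hf hD, hD.2.2.2.1, hD.2.2.2.2⟩

/-- **DIALS OF THE TUBE DOCKET (PROVED)**: colder moat and wider serenity radius are weaker. [this file, g67] -/
theorem MildTubeDocket.of_le {ϑm ϑm' ra ra' ϑp ϑf rb : ℝ} (h : ϑm' ≤ ϑm) (hra : ra ≤ ra') (hD : MildTubeDocket ϑm ra ϑp ϑf rb) :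
    MildTubeDocket ϑm' ra' ϑp ϑf rb :=
  ⟨hD.1.of_moat_le h, hD.2.1, hD.2.2.1, hD.2.2.2.1.of_moat_le h hra, hD.2.2.2.2.of_moat_le h hra⟩

/-- ★★ **THE MILD B-CHAIN FROM A TUBE DOCKET AT ANY MILD LEVEL (PROVED)**: `ϑf ≤ tameRadius`, `ϑ₁ ≤ ϑm`, `ra ≥ 24`, the tube docket at mild level `ϑp`, the wild leaf
[WHSᵇ](ϑp) AT THE SAME LEVEL and the observers' leaf [TBISᵇ(8)](ϑ₁, ω₁) give [BHSᵇ] — parts YG/YH's glue, generic in `ϑp`. [this file, g67] -/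
theorem bareHotSparseBPG_of_mildTube_wild_tameBallIncoherence {ϑm ra ϑp ϑf rb ϑ₁ ω₁ : ℝ} (hf : ϑf ≤ tameRadius) (hϑ₁ : ϑ₁ ≤ ϑm) (hra : 24 ≤ ra)
    (hD : MildTubeDocket ϑm ra ϑp ϑf rb) (hW : HotSparseBPG ϑp 1 2 (1 / 16) (1 / 50))
    (hTB : TameBallIncoherenceSparseBPG ϑ₁ ω₁ tameRadius 8 1 2 (1 / 16) (1 / 50)) :
    BareHotSparseBPG tameRadius dressLevel dressLevel dressExponent 8 collarRadius clusterSize 1 2 (1 / 16) (1 / 50) :=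
  bareHotSparseBPG_of_serene_tameBallIncoherence (by norm_num) (by linarith) hϑ₁
    (sereneBareHotSparseBPG_of_mild_hot (by norm_num) (by norm_num)
      (mildSereneBareHotSparseBPG_of_mildCoolMoat_slender_buried (by norm_num) (by norm_num) (by linarith) (by norm_num) (by norm_num)
        (mildCoolMoatCorePG_of_mildTubeDocket hf hD) hD.2.2.2.1 hD.2.2.2.2) hW) hTB

/-- ★★★ **COLUMN `_16XH28BN` — THE TUBE-CUT SIDE COLUMN.**  `_16XH28B` with its mild package AND its wild leaf replaced by ONE existential package over the five dials:
`∃ ϑm ra ϑp ϑf rb ϑ₁ ω₁, ϑf ≤ tameRadius ∧ ϑ₁ ≤ ϑm ∧ 24 ≤ ra ∧ 4ω₁ + ϑ₁ < tameRadius ∧ MildTubeDocket ϑm ra ϑp ϑf rb ∧ [WHSᵇ](ϑp) ∧ [TBISᵇ(8)](ϑ₁, ω₁)` — the door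
[MCMC] discharged into (QE) ∧ (QU)(rb) ∧ (QWᶠ)(rb) (all SIDEWAYS analytic leaves: a side column by the trade rule), the mild amplitude, the filling tameness and the near
radius chosen by the prover; [I_D], the 20 generic leaves and `PeriodicBulkGapDoor 2` unchanged ⇒ `VisibleGap (1/50) ∧ PertRegime (1/50)`. [this file, g67] -/
theorem gap_and_pert_1_50_of_certs_16XH28BN (hL : LatticeLiouvilleCert) (hL' : LayeredLiouvilleCert)
    (hR : OscRigidityL2BDPG 1 2 (1 / 16) (1 / 16)) (hX : ExcessFlatnessControlP 1 2 (1 / 16) (1 / 16))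
    (hE : ExcessChartLocalisationP 1 2 (1 / 16) (1 / 100)) (hP : RegistrationP 1 2 (1 / 16) (1 / 100))
    (hT : TailDominationCert) (hU : UniformTameStabilityE (1 / 50) 2 (1 / 2000))
    (h1 : WordTransplantP 1 2 (1 / 16) (1 / 100)) (hGT : GradReframingThickP 1 2 (1 / 16) (1 / 100) (1 / 50))
    (hΛ0 : LaunderingAprioriPX 1 2 (1 / 16) (1 / 100) (1 / 50)) (hΛs : LaunderingStepPX 1 2 (1 / 16) (1 / 100) (1 / 50))
    (hUc : UntwistCollarP 1 2 (1 / 16) (1 / 50))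
    (hl : BondIsoLevelsP 1 2 (1 / 16) (1 / 50)) (hN : EnergyNearChartPX 1 2 (1 / 16) (1 / 50) (1 / 2000))
    (hF : TailForceSlavingP 1 2 (1 / 16) (1 / 50))
    (hE' : LipDualLinearisationP 1 2 (1 / 16) (1 / 50)) (hA : L2HarmonicApproxPE 1 2 (1 / 16) (1 / 50) (1 / 2000))
    (hD : PositionDecayPLE 1 2 (1 / 16) (1 / 50) (1 / 2000)) (hC : PositionCaccioppoliPGE 1 2 (1 / 16) (1 / 50) (1 / 2000))
    (hI : DressedCorePG tameRadius dressLevel dressLevel dressExponent 8 collarRadius clusterSize 1 2 (1 / 16) (1 / 50))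
    (hTD : ∃ ϑm ra ϑp ϑf rb ϑ₁ ω₁ : ℝ, ϑf ≤ tameRadius ∧ ϑ₁ ≤ ϑm ∧ 24 ≤ ra ∧ 4 * ω₁ + ϑ₁ < tameRadius ∧ MildTubeDocket ϑm ra ϑp ϑf rb ∧
      HotSparseBPG ϑp 1 2 (1 / 16) (1 / 50) ∧ TameBallIncoherenceSparseBPG ϑ₁ ω₁ tameRadius 8 1 2 (1 / 16) (1 / 50))
    (hG : PeriodicBulkGapDoor 2) : VisibleGap (1 / 50) ∧ PertRegime (1 / 50) := by
  obtain ⟨ϑm, ra, ϑp, ϑf, rb, ϑ₁, ω₁, hf, hϑ₁, hra, hside, hMD, hW, hTB⟩ := hTD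
  exact gap_and_pert_1_50_of_certs_16XH18B_tol hL hL' hR hX hE hP hT hU h1 hGT hΛ0 hΛs hUc (untwistBookkeepingP_one 2 (1 / 50)) hl hN hF hE' hA hD hC
    (wildFractionBPG_of_dressedCore_serene_tameBallIncoherent hside (by norm_num) (by norm_num) (by linarith) hϑ₁ hI
      (sereneBareHotSparseBPG_of_mild_hot (by norm_num) (by norm_num)
        (mildSereneBareHotSparseBPG_of_mildCoolMoat_slender_buried (by norm_num) (by norm_num) (by linarith) (by norm_num) (by norm_num)
          (mildCoolMoatCorePG_of_mildTubeDocket hf hMD) hMD.2.2.2.1 hMD.2.2.2.2) hW) hTB) hG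

/-- ★ **THE RECORD BENEATH (QC) ⇒ THE TUBE DOCKET (PROVED)**: part YI's (QE) at output tameness `tameRadius` and part YL's (QU)(dm = 1/2) (the statement of record beneath
(QC), CRITIC-LEDGER row 1217) with the two mild serene leaves give `MildTubeDocket ϑm ra (1/10) tameRadius rb` for EVERY `0 ≤ rb ≤ 1/2` — BOTH new analytic leaves are
WEAKER than the leaf of record. [this file, g67] -/
theorem mildTubeDocket_of_record_leaves {ϑm ra rb : ℝ} (hrb0 : 0 ≤ rb) (hrb : rb ≤ 1 / 2)
    (hQE : CoolMoatSlavedFillingP ϑm tameRadius (1 / 10) 8 4 12 16 16 (1 / 2) 1 2 (1 / 16) (1 / 50))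
    (hQU : TubeCriticalUniquenessP tameRadius (1 / 10) 4 16 16 (1 / 2) 1 2 (1 / 16) (1 / 50))
    (hMSSH : MildSlenderSereneHotSparseBPG ϑm tameRadius 8 ra dressLevel dressLevel dressExponent 8 collarRadius clusterSize 4 32 8 (1 / 10) 24 1 2 (1 / 16) (1 / 50))
    (hMBSH : MildBuriedSereneHotSparseBPG ϑm tameRadius 8 ra dressLevel dressLevel dressExponent 8 collarRadius clusterSize 8 (1 / 10) 24 1 2 (1 / 16) (1 / 50)) :
    MildTubeDocket ϑm ra (1 / 10) tameRadius rb :=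
  ⟨hQE, hQU.anti_dm hrb, farTwinGapP_of_uniqueness hrb0 hQU, hMSSH, hMBSH⟩

/-- ★ **THE VARIATIONAL DOCKET ⇒ THE FAR LEAF (PROVED)**: part YI's (QC)(κ > 0) at the record gives (QWᶠ)(tameRadius, 1/10, 1/2, rb) for every `rb ≥ 0`. [this file, g67] -/
theorem farTwinGapP_record_of_variational {ϑm ra κ rb : ℝ} (hκ : 0 < κ) (hrb : 0 ≤ rb) (hV : VariationalMildDocket ϑm ra κ) :
    FarTwinGapP tameRadius (1 / 10) 4 16 16 (1 / 2) rb 1 2 (1 / 16) (1 / 50) :=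
  farTwinGapP_of_convexity hκ hrb hV.2.1

/-- ★★ **THE TUBE DOCKET FROM ITS CERTIFICATE FORM (PROVED)**: (QE)(ϑm, ϑf) ∧ (QH)(ϑf, ϑp, rb, 41, cN) (`cN > 3/500`, `rb ≤ 1/2`) ∧ (QWᶠ)(ϑf, ϑp, 1/2, rb) ∧ the two mild
serene leaves ⇒ `MildTubeDocket ϑm ra ϑp ϑf rb` — the near leaf in the form a stiffness certificate delivers. [this file, g67] -/
theorem mildTubeDocket_of_hessianFloor {ϑm ra ϑp ϑf rb cN : ℝ} (hrb : rb ≤ 1 / 2) (hcN : 3 / 500 < cN)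
    (hQE : CoolMoatSlavedFillingP ϑm ϑf ϑp 8 4 12 16 16 (1 / 2) 1 2 (1 / 16) (1 / 50))
    (hQH : NearHessianFloorP ϑf ϑp 4 16 16 rb 41 cN 1 2 (1 / 16) (1 / 50))
    (hQW : FarTwinGapP ϑf ϑp 4 16 16 (1 / 2) rb 1 2 (1 / 16) (1 / 50))
    (hMSSH : MildSlenderSereneHotSparseBPG ϑm tameRadius 8 ra dressLevel dressLevel dressExponent 8 collarRadius clusterSize 4 32 8 ϑp 24 1 2 (1 / 16) (1 / 50))
    (hMBSH : MildBuriedSereneHotSparseBPG ϑm tameRadius 8 ra dressLevel dressLevel dressExponent 8 collarRadius clusterSize 8 ϑp 24 1 2 (1 / 16) (1 / 50)) :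
    MildTubeDocket ϑm ra ϑp ϑf rb :=
  ⟨hQE, tubeCriticalUniquenessP_geom_of_hessianFloor hrb hcN hQH, hQW, hMSSH, hMBSH⟩

end TubeCut

end Summit.AtomisticToContinuum.Crystallization.Theorems.ChartedZeroExcessLayeredLatticeLiouville

end
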